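import Summits.NavierStokesRegularity.NavierStokesRegularity.Theorems.TypeICertificateLadderTargetRssStratumMirror
import Summits.NavierStokesRegularity.NavierStokesRegularity.Theorems.TypeICertificateLadderTargetRssStratumAxisymmetric
import Summits.NavierStokesRegularity.NavierStokesRegularity.Theorems.TypeICertificateLadderTargetRssCompactnessLimitProfile
import HarnessLib

/-!
# Crux `Target` (stmt-NavierStokesRegularity-1217), line `killing-twisted-bernoulli-solitons`,
  stub B5b: QUANTITATIVE CHIRALITY of window counterexamples

Support file (theorems only, `--supports stmt-NavierStokesRegularity-1217`), registered sub-goal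
`rssQuant_mirror_defect` of the c2 lead.

The mirror stratum (`rssStratum_mirror`, `TypeICertificateLadderTargetRssStratumMirror.lean`) says
that a non-trivial Type-I rotated self-similar profile of Pineau–Vicol's class is not symmetric
under the reflection `σ` in a meridian plane. By COMPACTNESS of the class (the extraction
`rssCompact_exists_limit_profile`, which also records the convergence of the profiles, and the
upgrade of the limit to a classical Pineau–Vicol-class solution, `rssCompact_limit_classical`) this
qualitative statement is automatically QUANTITATIVE and UNIFORM at each Type-I level:

* `rssQuant_mirror_defect` — for every `C₀ > 0` there is `δ = δ(C₀) > 0` such that EVERY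
  non-trivial Type-I (constant `C₀`) RSS profile `U` (any speed) has mirror defect
  `sup_y ‖U(σy) − σU(y)‖ ≥ δ`: a window counterexample is uniformly far from being bilaterally
  symmetric. (Speeds of counterexamples lie in the compact window `α₁ ≤ |α| ≤ α₂` of Theorem 1.4,
  `rssCompact_bad_subset_window`, so a defect-minimising sequence has a convergent subsequence of
  speeds with a NON-ZERO limit, where the mirror stratum applies to the limit profile.)
* `rssQuant_axisym_defect` — likewise a uniform `δ(C₀) > 0` lower bound on the pointwise
  axisymmetry defect `sup_{θ,y} ‖U(R_θy) − R_θU(y)‖` of every non-trivial profile.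

Honest scope: a necessary condition on counterexamples; B5b stays OPEN.

## References

* B. Pineau, V. Vicol, arXiv:2607.09619 (2026): Conj. 1.1, Theorem 1.4. [PineauVicol2026]
* D. Chae, J. Wolf, Comm. PDE 42 (2017) 1359–1374 = arXiv:1610.09464, §3. [ChaeWolf2017RemovingDSS]
-/

noncomputable section

namespace Summit.NavierStokesRegularity.NavierStokesRegularity.Theorems

open MeasureTheory Set Function Filter Metric Real
open scoped Topology ContDiff
open Literature.Analysis.FluidPDE Literature.Analysis.FluidPDE.PineauVicol2026

/-! ### The registered sub-goal -/

/-- **QUANTITATIVE CHIRALITY (registered sub-goal `rssQuant_mirror_defect`).** For every `C₀ > 0`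
there is `δ > 0` such that every NON-TRIVIAL Type-I (constant `C₀`) rotated self-similar profile of
Pineau–Vicol's class, at any speed, satisfies `‖U(σy) − σU(y)‖ ≥ δ` for some `y` (`σ = reflY`).
Compactness upgrade of the mirror stratum `rssStratum_mirror`. [cite: PineauVicol2026, Conj. 1.1 and Theorem 1.4; ChaeWolf2017RemovingDSS, §3] -/
theorem rssQuant_mirror_defect :
    ∀ (C₀ : ℝ), 0 < C₀ → ∃ δ : ℝ, 0 < δ ∧ ∀ (α : ℝ) (u : ℝ → EuclideanSpace ℝ (Fin 3) → EuclideanSpace ℝ (Fin 3)) (p : ℝ → EuclideanSpace ℝ (Fin 3) → ℝ) (U : EuclideanSpace ℝ (Fin 3) → EuclideanSpace ℝ (Fin 3)), Literature.Analysis.FluidPDE.IsClassicalNSSolutionOn (Set.Ico (-1) 0) 1 0 u p → (∀ t ∈ Set.Ico (-1 : ℝ) 0, ∀ x : EuclideanSpace ℝ (Fin 3), ‖u t x‖ ≤ C₀ / (‖x‖ + Real.sqrt (-t))) → ContDiff ℝ 2 U → (∀ t ∈ Set.Ico (-1 : ℝ) 0, ∀ x : EuclideanSpace ℝ (Fin 3),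 u t x = Literature.Analysis.FluidPDE.pvAnsatz α (fun y _ => U y) t x) → U ≠ 0 → ∃ y : EuclideanSpace ℝ (Fin 3), δ ≤ ‖U (Literature.Analysis.FluidPDE.reflY y) - Literature.Analysis.FluidPDE.reflY (U y)‖ := by
  intro C₀ hC₀
  by_contra H
  push Not at H
  -- profiles with mirror defect `< 1/(n+1)`
  have hpos : ∀ n : ℕ, (0 : ℝ) < 1 / ((n : ℝ) + 1) := fun n => by positivity
  choose α u p U hsol hI hU2 hans hne hdef using fun n : ℕ => H (1 / ((n : ℝ) + 1)) (hpos n)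
  -- the speeds lie in the compact window of Theorem 1.4
  obtain ⟨α₁, α₂, hα₁, -, hsub⟩ := rssCompact_bad_subset_window hC₀
  have hwin : ∀ n, α₁ ≤ |α n| ∧ |α n| ≤ α₂ := fun n =>
    hsub ⟨u n, p n, U n, hsol n, hI n, hU2 n, hans n, hne n⟩
  have hbd : ∀ n, α n ∈ Icc (-α₂) α₂ := fun n =>
    ⟨by linarith [neg_abs_le (α n), (hwin n).2], (le_abs_self _).trans (hwin n).2⟩
  obtain ⟨α₀, -, ψ, hψ, hαlim⟩ := tendsto_subseq_of_bounded (Metric.isBounded_Icc (-α₂) α₂) hbd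
  have hα₀ : α₀ ≠ 0 := by
    have h1 : α₁ ≤ |α₀| :=
      ge_of_tendsto (hαlim.abs) (Eventually.of_forall fun n => (hwin (ψ n)).1)
    intro h0
    rw [h0, abs_zero] at h1
    linarith
  -- backward extensions along the subsequence
  have hext := fun n => rssCompact_extend (hsol (ψ n)) (hI (ψ n)) (hans (ψ n))
  choose P hP using fun n => (hext n).1
  have hIw : ∀ n, HasTypeIDecay C₀ (pvAnsatz (α (ψ n)) (fun y _ => U (ψ n) y)) := fun n => (hext n).2
  obtain ⟨v, hvc, hvI, hweak, hss, ⟨x, hx⟩, φ, hφ, hprof⟩ :=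
    rssCompact_exists_limit_profile C₀ C₀ α₀ (fun _ => C₀) (α ∘ ψ) (U ∘ ψ) P hC₀ (fun _ => hC₀.le)
      (fun _ => le_rfl) tendsto_const_nhds hαlim hP hIw fun n => hne (ψ n)
  -- the limit profile is mirror symmetric
  have hmirror : ∀ y : EuclideanSpace ℝ (Fin 3), v (-1) (reflY y) = reflY (v (-1) y) := by
    intro y
    have h1 : Tendsto (fun n => U (ψ (φ n)) (reflY y) - reflY (U (ψ (φ n)) y)) atTop
        (𝓝 (v (-1) (reflY y) - reflY (v (-1) y))) :=
      (hprof (reflY y)).sub ((reflY.continuous.tendsto _).comp (hprof y))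
    have h2 : Tendsto (fun n => U (ψ (φ n)) (reflY y) - reflY (U (ψ (φ n)) y)) atTop (𝓝 0) := by
      rw [tendsto_zero_iff_norm_tendsto_zero]
      have hb : ∀ n, ‖U (ψ (φ n)) (reflY y) - reflY (U (ψ (φ n)) y)‖ ≤ 1 / ((ψ (φ n) : ℝ) + 1) :=
        fun n => (hdef (ψ (φ n)) y).le
      refine squeeze_zero (fun n => norm_nonneg _) hb ?_
      have hmono : Tendsto (fun n => ψ (φ n)) atTop atTop :=
        hψ.tendsto_atTop.comp hφ.tendsto_atTop
      exact tendsto_one_div_add_atTop_nhds_zero_nat.comp hmono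
    have := tendsto_nhds_unique h1 h2
    exact sub_eq_zero.1 this
  -- the limit is a non-trivial classical Pineau–Vicol-class solution of speed `α₀ ≠ 0`
  obtain ⟨hsmooth, ⟨Q, hQ⟩, hIv, -⟩ := rssCompact_limit_classical C₀ α₀ v hvc hvI hweak hss
  have hcl : IsClassicalNSSolutionOn (Ico (-1) 0) 1 0 (pvAnsatz α₀ (fun y _ => v (-1) y)) Q :=
    hQ.mono Ico_subset_Iio_self (uniqueDiffOn_Ico _ _)
  have h2 : ContDiff ℝ 2 (v (-1)) := contDiff_infty.1 hsmooth 2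
  have hzero := rssStratum_mirror C₀ α₀ hα₀ _ Q (v (-1)) hcl (fun t ht z => hIv t ht.2 z) h2
    (fun _ _ _ => rfl) hmirror
  exact hx (by rw [hzero]; rfl)


/-- **QUANTITATIVE NON-AXISYMMETRY (registered sub-goal `rssQuant_axisym_defect`).** For every
`C₀ > 0` there is `δ > 0` such that every NON-TRIVIAL Type-I (constant `C₀`) rotated self-similar
profile of Pineau–Vicol's class, at any speed, has `‖U(R_θ y) − R_θ U(y)‖ ≥ δ` for some angle `θ`
and point `y`. Compactness upgrade of the axisymmetric stratum `rssStratum_axisymmetric` (the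
pointwise-sup counterpart of the weighted rotation-defect stratum `rotationDefect_liouville`). [cite: PineauVicol2026, Conj. 1.1 and Theorem 1.4; KochNadirashviliSereginSverak2009, Thm. 5.3] -/
theorem rssQuant_axisym_defect :
    ∀ (C₀ : ℝ), 0 < C₀ → ∃ δ : ℝ, 0 < δ ∧ ∀ (α : ℝ) (u : ℝ → EuclideanSpace ℝ (Fin 3) → EuclideanSpace ℝ (Fin 3)) (p : ℝ → EuclideanSpace ℝ (Fin 3) → ℝ) (U : EuclideanSpace ℝ (Fin 3) → EuclideanSpace ℝ (Fin 3)), Literature.Analysis.FluidPDE.IsClassicalNSSolutionOn (Set.Ico (-1) 0) 1 0 u p → (∀ t ∈ Set.Ico (-1 : ℝ) 0, ∀ x : EuclideanSpace ℝ (Fin 3), ‖u t x‖ ≤ C₀ / (‖x‖ + Real.sqrt (-t))) → ContDiff ℝ 2 U → (∀ t ∈ Set.Ico (-1 : ℝ) 0, ∀ x : EuclideanSpace ℝ (Fin 3), u t x = Literature.Analysis.FluidPDE.pvAnsatz α (fun y _ => U y) t x) → U ≠ 0 → ∃ (θ : ℝ) (y : EuclideanSpace ℝ (Fin 3)), δ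 ≤ ‖U (Literature.Analysis.FluidPDE.rotZ θ y) - Literature.Analysis.FluidPDE.rotZ θ (U y)‖ := by
  intro C₀ hC₀
  by_contra H
  push Not at H
  have hpos : ∀ n : ℕ, (0 : ℝ) < 1 / ((n : ℝ) + 1) := fun n => by positivity
  choose α u p U hsol hI hU2 hans hne hdef using fun n : ℕ => H (1 / ((n : ℝ) + 1)) (hpos n)
  -- the speeds lie in the compact window of Theorem 1.4
  obtain ⟨α₁, α₂, -, -, hsub⟩ := rssCompact_bad_subset_window hC₀
  have hwin : ∀ n, α₁ ≤ |α n| ∧ |α n| ≤ α₂ := fun n =>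
    hsub ⟨u n, p n, U n, hsol n, hI n, hU2 n, hans n, hne n⟩
  have hbd : ∀ n, α n ∈ Icc (-α₂) α₂ := fun n =>
    ⟨by linarith [neg_abs_le (α n), (hwin n).2], (le_abs_self _).trans (hwin n).2⟩
  obtain ⟨α₀, -, ψ, hψ, hαlim⟩ := tendsto_subseq_of_bounded (Metric.isBounded_Icc (-α₂) α₂) hbd
  -- backward extensions along the subsequence
  have hext := fun n => rssCompact_extend (hsol (ψ n)) (hI (ψ n)) (hans (ψ n))
  choose P hP using fun n => (hext n).1
  have hIw : ∀ n, HasTypeIDecay C₀ (pvAnsatz (α (ψ n)) (fun y _ => U (ψ n) y)) := fun n => (hext n).2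
  obtain ⟨v, hvc, hvI, hweak, hss, ⟨x, hx⟩, φ, hφ, hprof⟩ :=
    rssCompact_exists_limit_profile C₀ C₀ α₀ (fun _ => C₀) (α ∘ ψ) (U ∘ ψ) P hC₀ (fun _ => hC₀.le)
      (fun _ => le_rfl) tendsto_const_nhds hαlim hP hIw fun n => hne (ψ n)
  -- the limit profile is axisymmetric
  have hax : IsAxisymmetric (v (-1)) := by
    intro θ y
    have h1 : Tendsto (fun n => U (ψ (φ n)) (rotZ θ y) - rotZ θ (U (ψ (φ n)) y)) atTop
        (𝓝 (v (-1) (rotZ θ y) - rotZ θ (v (-1) y))) :=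
      (hprof (rotZ θ y)).sub (((rotZL θ).continuous.tendsto _).comp (hprof y))
    have h2 : Tendsto (fun n => U (ψ (φ n)) (rotZ θ y) - rotZ θ (U (ψ (φ n)) y)) atTop (𝓝 0) := by
      rw [tendsto_zero_iff_norm_tendsto_zero]
      have hb : ∀ n, ‖U (ψ (φ n)) (rotZ θ y) - rotZ θ (U (ψ (φ n)) y)‖ ≤ 1 / ((ψ (φ n) : ℝ) + 1) :=
        fun n => (hdef (ψ (φ n)) θ y).le
      refine squeeze_zero (fun n => norm_nonneg _) hb ?_
      have hmono : Tendsto (fun n => ψ (φ n)) atTop atTop :=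
        hψ.tendsto_atTop.comp hφ.tendsto_atTop
      exact tendsto_one_div_add_atTop_nhds_zero_nat.comp hmono
    have := tendsto_nhds_unique h1 h2
    exact sub_eq_zero.1 this
  -- the limit is a non-trivial classical Pineau–Vicol-class solution
  obtain ⟨hsmooth, ⟨Q, hQ⟩, hIv, -⟩ := rssCompact_limit_classical C₀ α₀ v hvc hvI hweak hss
  have hcl : IsClassicalNSSolutionOn (Ico (-1) 0) 1 0 (pvAnsatz α₀ (fun y _ => v (-1) y)) Q :=
    hQ.mono Ico_subset_Iio_self (uniqueDiffOn_Ico _ _)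
  have h2 : ContDiff ℝ 2 (v (-1)) := contDiff_infty.1 hsmooth 2
  have hzero := rssStratum_axisymmetric C₀ α₀ _ Q (v (-1)) hcl (fun t ht z => hIv t ht.2 z) h2
    (fun _ _ _ => rfl) hax
  exact hx (by rw [hzero]; rfl)

end Summit.NavierStokesRegularity.NavierStokesRegularity.Theorems

end
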